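import Literature.Analysis.FluidPDE.AdaptedBackwardKernel
import Literature.Analysis.FluidPDE.VectorCalculus
import Literature.Analysis.FluidPDE.WholeSpaceIBP
import Literature.Analysis.FluidPDE.SpaceTimeCalculus

/-! # Kernel calculus I: first variation of a cut-off functional against an adapted backward kernel — crux stmt-NavierStokesRegularity-10493 (`AdaptedFrequency.AdaptedFrequencyConverges`), line tauberian-omega-limit, stub stub_kernelCalculus

Helper file 1/3 (`--supports stmt-NavierStokesRegularity-10493`) for the registered stub
`stub_kernelCalculus` (differentiability of the adapted enstrophy `H(t) = ∫ ‖curl u(t)‖² G(t)`).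
Let `G` be a flow-adapted backward kernel of `∂ₜ + u·∇ − νΔ` on a time set `S`
(`IsAdaptedBackwardKernel ν u S T x₀ G`: jointly `C²`, positive, adjoint equation
`∂ₜG + u·∇G + νΔG = 0`, unit mass), `S₀ ⊆ S` open, `u` a divergence-free `C¹` drift and `q` a
jointly `C²` scalar field on `S₀ × E` (`E` a finite-dimensional real inner product space). This
file proves, for the cut-off functionals `Φ_R(s) = ∫ q(s) χ_R G(s)` (`χ_R = cutoff R`, the tree's
smooth cut-off of `WholeSpaceIBP`), the **transport-free first variation**
`Φ_R′(s) = ∫ [∂ₜq χ_R + u·∇(q χ_R) − νΔ(q χ_R)] G(s)` at every `s ∈ S₀`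
(`kernelCalculus_hasDerivAt_cutoffIntegral`): differentiate under the integral sign on the compact
support (`kernelCalculus_hasDerivAt_integral_of_support`, jointly `C¹` integrands), insert the
adjoint equation for `∂ₜG` (a two-sided time derivative at the interior time `s`) and integrate by
parts without boundary terms (`kernelCalculus_integral_mul_fderiv_apply`, using `div u = 0`, and
`kernelCalculus_integral_mul_laplacian`, Green's second identity). Only the values of `G`, `∇G`,
`ΔG` on a compact set enter, so no decay of the derivatives of `G` is needed. This is the identity
`d/dt ∫ q G = ∫ (∂ₜq + u·∇q − νΔq) G` behind the notion of adapted kernel (Friedman 1964, Ch. 1 §8,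
adjoint equation (8.1)–(8.3); Poon 1996, first variation of the parabolic frequency), here with a
cut-off; files 2/3 (`…StubKernelCalculusCore`) and 3/3 (`…StubKernelCalculus`) remove the cut-off
and specialise to `q = ‖curl u‖²` on `ℝ³`.
-/

noncomputable section

open scoped Topology InnerProductSpace RealInnerProductSpace Laplacian ContDiff
open Literature.Analysis.FluidPDE Set Filter MeasureTheory Function Metric

namespace Summit.NavierStokesRegularity.NavierStokesRegularity.Theorems.AdaptedFrequencyConverges.TauberianOmegaLimit

section General

variable {E : Type*} [NormedAddCommGroup E] [InnerProductSpace ℝ E]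

/-! ### Pointwise tools -/

section Slices

/-- Slices of a jointly `Cⁿ` field on an open time set are `Cⁿ`. -/
theorem kernelCalculus_contDiff_slice {F : Type*} [NormedAddCommGroup F] [NormedSpace ℝ F]
    {f : ℝ → E → F} {S₀ : Set ℝ} {n : WithTop ℕ∞} (hf : ContDiffOn ℝ n (uncurry f) (S₀ ×ˢ univ))
    {s : ℝ} (hs : s ∈ S₀) : ContDiff ℝ n (f s) := by
  have hc : ContDiff ℝ n (fun x : E => ((s, x) : ℝ × E)) := contDiff_const.prodMk contDiff_id
  have := hf.comp_contDiff hc (fun x => mk_mem_prod hs (mem_univ x))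
  simpa [Function.comp_def] using this

/-- Time lines of a jointly `Cⁿ` field (`1 ≤ n`) on an open time set: `r ↦ f r x` has derivative
`D(uncurry f)(s, x)(1, 0)` at `s ∈ S₀`. -/
theorem kernelCalculus_hasDerivAt_timeLine {F : Type*} [NormedAddCommGroup F] [NormedSpace ℝ F]
    {f : ℝ → E → F} {S₀ : Set ℝ} {n : WithTop ℕ∞} (hS₀ : IsOpen S₀)
    (hf : ContDiffOn ℝ n (uncurry f) (S₀ ×ˢ univ)) (hn : 1 ≤ n) {s : ℝ} (hs : s ∈ S₀) (x : E) :
    HasDerivAt (fun r => f r x) (fderiv ℝ (uncurry f) (s, x) (1, 0)) s :=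
  hasDerivAt_timeLine (((hf.differentiableOn
    (ENat.one_le_iff_ne_zero_withTop.mp hn)).differentiableAt
    ((hS₀.prod isOpen_univ).mem_nhds ⟨hs, mem_univ x⟩)).hasFDerivAt)

/-- The time-derivative field `x ↦ D(uncurry f)(s, x)(1, 0)` of a jointly `Cⁿ` field (`1 ≤ n`)
is continuous in `x`. -/
theorem kernelCalculus_continuous_derivField {F : Type*} [NormedAddCommGroup F] [NormedSpace ℝ F]
    {f : ℝ → E → F} {S₀ : Set ℝ} {n : WithTop ℕ∞} (hS₀ : IsOpen S₀)
    (hf : ContDiffOn ℝ n (uncurry f) (S₀ ×ˢ univ)) (hn : 1 ≤ n) {s : ℝ} (hs : s ∈ S₀) :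
    Continuous fun x : E => fderiv ℝ (uncurry f) (s, x) (1, 0) := by
  have h1 : ContinuousOn (fderiv ℝ (uncurry f)) (S₀ ×ˢ univ) :=
    hf.continuousOn_fderiv_of_isOpen (hS₀.prod isOpen_univ) hn
  have h2 : Continuous fun x : E => fderiv ℝ (uncurry f) (s, x) :=
    h1.comp_continuous (continuous_const.prodMk continuous_id) fun x => ⟨hs, mem_univ x⟩
  exact h2.clm_apply continuous_const

end Slices

variable [FiniteDimensional ℝ E]

/-- The Laplacian is controlled by the second derivative: `‖Δ v (x)‖ ≤ n ‖D²v(x)‖`,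
`n = dim E` (`Δ v (x) = Σᵢ D²v(x)(eᵢ, eᵢ)` over an orthonormal basis). -/
theorem kernelCalculus_norm_laplacian_le {F : Type*} [NormedAddCommGroup F] [NormedSpace ℝ F]
    (v : E → F) (x : E) :
    ‖(Δ v) x‖ ≤ Module.finrank ℝ E * ‖iteratedFDeriv ℝ 2 v x‖ := by
  rw [InnerProductSpace.laplacian_eq_iteratedFDeriv_stdOrthonormalBasis]
  set b := stdOrthonormalBasis ℝ E
  refine (norm_sum_le _ _).trans ?_
  have hterm : ∀ i, ‖iteratedFDeriv ℝ 2 v x ![b i, b i]‖ ≤ ‖iteratedFDeriv ℝ 2 v x‖ := fun i => by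
    refine (ContinuousMultilinearMap.le_opNorm _ _).trans ?_
    rw [Fin.prod_univ_two, Matrix.cons_val_zero, Matrix.cons_val_one, Matrix.cons_val_zero,
      b.orthonormal.1 i, mul_one, mul_one]
  refine (Finset.sum_le_sum fun i _ => hterm i).trans ?_
  rw [Finset.sum_const, Finset.card_univ, Fintype.card_fin, nsmul_eq_mul]


variable [MeasurableSpace E] [BorelSpace E]

/-! ### Integration by parts against the kernel slice -/

/-- `∫ θ ΔG = ∫ (Δθ) G` for `θ ∈ C²_c` and `G ∈ C²` (Green's second identity without boundary
terms: the tree's `integral_inner_laplacian_add_eq_zero` twice). -/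
theorem kernelCalculus_integral_mul_laplacian {θ g : E → ℝ} (hθ : ContDiff ℝ 2 θ)
    (hθc : HasCompactSupport θ) (hg : ContDiff ℝ 2 g) :
    ∫ x, θ x * (Δ g) x = ∫ x, (Δ θ) x * g x := by
  set b := stdOrthonormalBasis ℝ E
  have h1 := integral_inner_laplacian_add_eq_zero b hg (hθ.of_le one_le_two) (Or.inr hθc)
  have h2 := integral_inner_laplacian_add_eq_zero b hθ (hg.of_le one_le_two) (Or.inl hθc)
  have hsum : ∑ i, ∫ x, ⟪fderiv ℝ g x (b i), fderiv ℝ θ x (b i)⟫ =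
      ∑ i, ∫ x, ⟪fderiv ℝ θ x (b i), fderiv ℝ g x (b i)⟫ :=
    Finset.sum_congr rfl fun i _ => integral_congr_ae (Eventually.of_forall fun x =>
      real_inner_comm _ _)
  have h3 : ∫ x, ⟪(Δ g) x, θ x⟫ = ∫ x, ⟪(Δ θ) x, g x⟫ := by linarith
  have e1 : ∫ x, θ x * (Δ g) x = ∫ x, ⟪(Δ g) x, θ x⟫ :=
    integral_congr_ae (Eventually.of_forall fun x => by simp only [Real.inner_apply, mul_comm])
  have e2 : ∫ x, (Δ θ) x * g x = ∫ x, ⟪(Δ θ) x, g x⟫ :=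
    integral_congr_ae (Eventually.of_forall fun x => by simp only [Real.inner_apply])
  rw [e1, e2, h3]

/-- `∫ θ (DG · v) = -∫ (Dθ · v) G` for `θ ∈ C¹_c`, `G ∈ C¹` and a divergence-free `C¹` drift `v`
(`div (θ G v) = G (v·∇θ) + θ (v·∇G)` integrates to zero). -/
theorem kernelCalculus_integral_mul_fderiv_apply {θ g : E → ℝ} {v : E → E} (hθ : ContDiff ℝ 1 θ)
    (hθc : HasCompactSupport θ) (hg : ContDiff ℝ 1 g) (hv : ContDiff ℝ 1 v)
    (hdiv : VectorCalculus.IsDivFree v) :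
    ∫ x, θ x * fderiv ℝ g x (v x) = -∫ x, fderiv ℝ θ x (v x) * g x := by
  have hθg : ContDiff ℝ 1 fun x => θ x * g x := hθ.mul hg
  have hθgc : HasCompactSupport fun x => θ x * g x := hθc.mul_right
  have h := integral_mul_divergence_add_eq_zero_left hθg hv hθgc
  have hz : (fun x => θ x * g x * VectorCalculus.divergence v x) = fun _ => 0 := by
    funext x; rw [hdiv x, mul_zero]
  rw [hz, integral_zero, zero_add] at h
  have hpt : ∀ x, ⟪v x, gradient (fun x => θ x * g x) x⟫ =
      θ x * fderiv ℝ g x (v x) + fderiv ℝ θ x (v x) * g x := fun x => by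
    rw [real_inner_comm, gradient, InnerProductSpace.toDual_symm_apply,
      fderiv_fun_mul (hθ.differentiable one_ne_zero x) (hg.differentiable one_ne_zero x)]
    simp [mul_comm]
  simp_rw [hpt] at h
  have hi₁ : Integrable (fun x => θ x * fderiv ℝ g x (v x)) (volume : Measure E) :=
    (hθ.continuous.mul ((hg.continuous_fderiv one_ne_zero).clm_apply hv.continuous))
      |>.integrable_of_hasCompactSupport hθc.mul_right
  have hi₂ : Integrable (fun x => fderiv ℝ θ x (v x) * g x) (volume : Measure E) := by
    refine (((hθ.continuous_fderiv one_ne_zero).clm_apply hv.continuous).mul hg.continuous)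
      |>.integrable_of_hasCompactSupport ((hθc.fderiv (𝕜 := ℝ)).mono fun x hx => ?_)
    rw [mem_support] at hx ⊢
    contrapose! hx
    simp [hx]
  rw [integral_add hi₁ hi₂] at h
  linarith

/-! ### Differentiation under the integral sign (jointly `C¹`, uniformly compact support) -/

/-- For `Φ` jointly `C¹` on an open time set `S₀`, with slices supported in a fixed compact `K`,
`d/ds ∫ Φ s x dx = ∫ D(uncurry Φ)(s, x)(1, 0) dx` at every `s ∈ S₀` (dominated differentiation,
the derivative being bounded on `[s - δ, s + δ] × K`). -/
theorem kernelCalculus_hasDerivAt_integral_of_support {Φ : ℝ → E → ℝ} {S₀ : Set ℝ}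
    (hS₀ : IsOpen S₀) (hΦ : ContDiffOn ℝ 1 (uncurry Φ) (S₀ ×ˢ univ)) {K : Set E}
    (hK : IsCompact K) (hsupp : ∀ s ∈ S₀, ∀ x ∉ K, Φ s x = 0) {t : ℝ} (ht : t ∈ S₀) :
    HasDerivAt (fun s => ∫ x, Φ s x) (∫ x, fderiv ℝ (uncurry Φ) (t, x) (1, 0)) t := by
  have hO : IsOpen (S₀ ×ˢ (univ : Set E)) := hS₀.prod isOpen_univ
  obtain ⟨Φ', hΦ'⟩ : ∃ Φ' : ℝ → E → ℝ, Φ' = fun s x => fderiv ℝ (uncurry Φ) (s, x) (1, 0) :=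
    ⟨_, rfl⟩
  have hΦ'c : ContinuousOn (uncurry Φ') (S₀ ×ˢ univ) := by
    rw [hΦ']
    exact (hΦ.continuousOn_fderiv_of_isOpen hO le_rfl).clm_apply continuousOn_const
  have hline : ∀ s ∈ S₀, ∀ x, HasDerivAt (fun r => Φ r x) (Φ' s x) s := fun s hs x => by
    rw [hΦ']; exact kernelCalculus_hasDerivAt_timeLine hS₀ hΦ le_rfl hs x
  have hslice : ∀ s ∈ S₀, Continuous (Φ s) := fun s hs =>
    (kernelCalculus_contDiff_slice hΦ hs).continuous
  -- `Φ' s x = 0` off `K`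
  have hsupp' : ∀ s ∈ S₀, ∀ x ∉ K, Φ' s x = 0 := by
    intro s hs x hx
    have h0 : (fun r => Φ r x) =ᶠ[𝓝 s] fun _ => (0 : ℝ) := by
      filter_upwards [hS₀.mem_nhds hs] with r hr using hsupp r hr x hx
    rw [← (hline s hs x).deriv, h0.deriv_eq, deriv_const]
  -- a compact time-neighbourhood `[t - δ/2, t + δ/2] ⊆ S₀`
  obtain ⟨δ, hδ, hball⟩ := Metric.isOpen_iff.1 hS₀ t ht
  have hIcc : Icc (t - δ / 2) (t + δ / 2) ⊆ S₀ := fun s hs => hball <| by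
    rw [Metric.mem_ball, Real.dist_eq, abs_lt]
    constructor <;> linarith [hs.1, hs.2]
  have hnhds : Icc (t - δ / 2) (t + δ / 2) ∈ 𝓝 t := Icc_mem_nhds (by linarith) (by linarith)
  obtain ⟨M, hM⟩ : ∃ M, ∀ z ∈ Icc (t - δ / 2) (t + δ / 2) ×ˢ K, ‖uncurry Φ' z‖ ≤ M :=
    (isCompact_Icc.prod hK).exists_bound_of_continuousOn
      (hΦ'c.mono (prod_mono hIcc (subset_univ _)))
  have key := hasDerivAt_integral_of_dominated_loc_of_deriv_le (μ := volume) (F := Φ) (F' := Φ')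
    (x₀ := t) (bound := K.indicator fun _ => M) hnhds ?_ ?_ ?_ ?_ ?_ ?_
  · simpa only [hΦ'] using key.2
  · filter_upwards [hS₀.mem_nhds ht] with s hs using (hslice s hs).aestronglyMeasurable
  · exact (hslice t ht).integrable_of_hasCompactSupport (HasCompactSupport.intro hK (hsupp t ht))
  · exact (hΦ'c.comp_continuous (continuous_const.prodMk continuous_id)
      fun x => ⟨ht, mem_univ x⟩).aestronglyMeasurable
  · refine Eventually.of_forall fun x s hs => ?_
    by_cases hx : x ∈ K
    · rw [indicator_of_mem hx]
      exact hM (s, x) (mk_mem_prod hs hx)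
    · rw [indicator_of_notMem hx, hsupp' s (hIcc hs) x hx, norm_zero]
  · exact (integrable_indicator_iff hK.measurableSet).2
      (integrableOn_const hK.measure_lt_top.ne)
  · exact Eventually.of_forall fun x s hs => hline s (hIcc hs) x

/-! ### Step A: the first variation of the cut-off functional `∫ q χ_R G` -/

/-- **First variation with a cut-off.** For an adapted kernel `G` of `∂ₜ + u·∇ − νΔ` on `S`, an
open `S₀ ⊆ S`, a divergence-free `C¹` drift, a jointly `C²` scalar field `q` on `S₀ × E` and
`R > 0`, the cut-off functional `r ↦ ∫ q(r) χ_R G(r)` is differentiable at every `s ∈ S₀` with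
derivative `∫ [∂ₜq χ_R + u·∇(q χ_R) − νΔ(q χ_R)] G(s)`: differentiate under the integral sign on
the compact support, insert the adjoint equation `∂ₜG = −u·∇G − νΔG` (two-sided time derivative at
the interior time `s`) and integrate by parts (`div u = 0`). Only values of `G`, `∇G`, `ΔG` on a
compact set enter. -/
theorem kernelCalculus_hasDerivAt_cutoffIntegral {ν T : ℝ} {u : ℝ → E → E} {S S₀ : Set ℝ}
    {x₀ : E} {G q : ℝ → E → ℝ} (hG : IsAdaptedBackwardKernel ν u S T x₀ G) (hS₀ : IsOpen S₀)
    (hS₀S : S₀ ⊆ S) (hu1 : ∀ t ∈ S₀, ContDiff ℝ 1 (u t))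
    (hdiv : ∀ t ∈ S₀, VectorCalculus.IsDivFree (u t))
    (hq : ContDiffOn ℝ 2 (uncurry q) (S₀ ×ˢ univ)) {R : ℝ} (hR : 0 < R) {s : ℝ} (hs : s ∈ S₀) :
    HasDerivAt (fun r => ∫ x, q r x * cutoff R x * G r x)
      (∫ x, (fderiv ℝ (uncurry q) (s, x) (1, 0) * cutoff R x +
          fderiv ℝ (fun y => q s y * cutoff R y) x (u s x) -
          ν * (Δ (fun y => q s y * cutoff R y)) x) * G s x) s := by
  have hG2 : ContDiffOn ℝ 2 (uncurry G) (S₀ ×ˢ univ) :=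
    hG.contDiffOn.mono (prod_mono hS₀S Subset.rfl)
  -- slices
  have hqs : ContDiff ℝ 2 (q s) := kernelCalculus_contDiff_slice hq hs
  have hGs : ContDiff ℝ 2 (G s) := kernelCalculus_contDiff_slice hG2 hs
  have hχ : ContDiff ℝ 2 (cutoff (E := E) R) := contDiff_cutoff R
  have hus : Continuous (u s) := (hu1 s hs).continuous
  obtain ⟨θ, hθdef⟩ : ∃ θ : E → ℝ, θ = fun y => q s y * cutoff R y := ⟨_, rfl⟩
  have hθ : ContDiff ℝ 2 θ := hθdef ▸ hqs.mul hχ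
  have hθc : HasCompactSupport θ := hθdef ▸ (hasCompactSupport_cutoff hR).mul_left
  -- (i) differentiate under the integral sign
  obtain ⟨Φ, hΦ⟩ : ∃ Φ : ℝ → E → ℝ, Φ = fun r x => q r x * cutoff R x * G r x := ⟨_, rfl⟩
  have hΦ1 : ContDiffOn ℝ 1 (uncurry Φ) (S₀ ×ˢ univ) := by
    have h1 : ContDiffOn ℝ 1 (fun z : ℝ × E => uncurry q z * cutoff R z.2 * uncurry G z)
        (S₀ ×ˢ univ) :=
      ((hq.of_le one_le_two).mul ((hχ.of_le one_le_two).comp_contDiffOn contDiffOn_snd)).mul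
        (hG2.of_le one_le_two)
    rw [hΦ]; exact h1
  have hsuppΦ : ∀ r ∈ S₀, ∀ x ∉ closedBall (0 : E) (2 * R), Φ r x = 0 := by
    intro r _ x hx
    rw [mem_closedBall_zero_iff, not_le] at hx
    simp [hΦ, cutoff_eq_zero hR hx.le]
  have hA := kernelCalculus_hasDerivAt_integral_of_support hS₀ hΦ1 (isCompact_closedBall 0 (2 * R))
    hsuppΦ hs
  -- (ii) the pointwise time derivative, with the adjoint equation inserted
  have hqline : ∀ x, HasDerivAt (fun r => q r x) (fderiv ℝ (uncurry q) (s, x) (1, 0)) s := fun x =>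
    kernelCalculus_hasDerivAt_timeLine hS₀ hq (by norm_num) hs x
  have hGline : ∀ x, HasDerivAt (fun r => G r x)
      (-(fderiv ℝ (G s) x (u s x) + ν * (Δ (G s)) x)) s := by
    intro x
    have h1 := kernelCalculus_hasDerivAt_timeLine hS₀ hG2 (by norm_num) hs x
    have heq := hG.adjoint_eq s (hS₀S hs) x
    rw [timeDerivWithin_apply, derivWithin_of_mem_nhds (mem_of_superset (hS₀.mem_nhds hs) hS₀S),
      h1.deriv] at heq
    exact h1.congr_deriv (by linarith)
  have hpt : ∀ x, fderiv ℝ (uncurry Φ) (s, x) (1, 0) =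
      fderiv ℝ (uncurry q) (s, x) (1, 0) * cutoff R x * G s x -
        θ x * fderiv ℝ (G s) x (u s x) - ν * (θ x * (Δ (G s)) x) := by
    intro x
    have h1 : HasDerivAt (fun r => Φ r x) (fderiv ℝ (uncurry Φ) (s, x) (1, 0)) s :=
      kernelCalculus_hasDerivAt_timeLine hS₀ hΦ1 le_rfl hs x
    have h2 : HasDerivAt (fun r => Φ r x)
        (fderiv ℝ (uncurry q) (s, x) (1, 0) * cutoff R x * G s x +
          q s x * cutoff R x * -(fderiv ℝ (G s) x (u s x) + ν * (Δ (G s)) x)) s := by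
      rw [hΦ]; exact ((hqline x).mul_const (cutoff R x)).mul (hGline x)
    rw [h1.unique h2, hθdef]
    ring
  -- (iii) integrability: everything is continuous and supported in `B̄(0, 2R + 1)`
  have hfar : ∀ x ∉ closedBall (0 : E) (2 * R + 1), x ∉ tsupport θ ∧ cutoff R x = 0 := by
    intro x hx
    rw [mem_closedBall_zero_iff, not_le] at hx
    refine ⟨?_, cutoff_eq_zero hR (by linarith)⟩
    rw [notMem_tsupport_iff_eventuallyEq]
    filter_upwards [Metric.ball_mem_nhds x one_pos] with y hy
    rw [mem_ball, dist_eq_norm] at hy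
    have h1 : ‖x‖ - ‖y‖ ≤ ‖x - y‖ := norm_sub_norm_le x y
    rw [norm_sub_rev] at h1
    have hy' : 2 * R ≤ ‖y‖ := by linarith
    simp [hθdef, cutoff_eq_zero hR hy']
  have hint : ∀ {f : E → ℝ}, Continuous f → (∀ x ∉ closedBall (0 : E) (2 * R + 1), f x = 0) →
      Integrable f := fun hf h0 =>
    hf.integrable_of_hasCompactSupport (HasCompactSupport.intro (isCompact_closedBall _ _) h0)
  have hθ0 : ∀ x ∉ closedBall (0 : E) (2 * R + 1), θ x = 0 := fun x hx =>
    image_eq_zero_of_notMem_tsupport (hfar x hx).1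
  have hqtc : Continuous fun x => fderiv ℝ (uncurry q) (s, x) (1, 0) :=
    kernelCalculus_continuous_derivField hS₀ hq (by norm_num) hs
  have hiA : Integrable fun x => fderiv ℝ (uncurry q) (s, x) (1, 0) * cutoff R x * G s x :=
    hint ((hqtc.mul hχ.continuous).mul hGs.continuous) fun x hx => by simp [(hfar x hx).2]
  have hiB : Integrable fun x => θ x * fderiv ℝ (G s) x (u s x) :=
    hint (hθ.continuous.mul ((hGs.continuous_fderiv (by norm_num)).clm_apply hus))
      fun x hx => by simp [hθ0 x hx]
  have hiC : Integrable fun x => θ x * (Δ (G s)) x :=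
    hint (hθ.continuous.mul (continuous_laplacian hGs)) fun x hx => by simp [hθ0 x hx]
  have hiB' : Integrable fun x => fderiv ℝ θ x (u s x) * G s x :=
    hint (((hθ.continuous_fderiv (by norm_num)).clm_apply hus).mul hGs.continuous)
      fun x hx => by simp [fderiv_of_notMem_tsupport ℝ (hfar x hx).1]
  have hiC' : Integrable fun x => (Δ θ) x * G s x :=
    hint ((continuous_laplacian hθ).mul hGs.continuous)
      fun x hx => by simp [laplacian_eq_zero_of_notMem_tsupport (hfar x hx).1]
  -- (iv) integrate by parts
  have hI1 : ∫ x, θ x * fderiv ℝ (G s) x (u s x) = -∫ x, fderiv ℝ θ x (u s x) * G s x :=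
    kernelCalculus_integral_mul_fderiv_apply (hθ.of_le one_le_two) hθc (hGs.of_le one_le_two)
      (hu1 s hs) (hdiv s hs)
  have hI2 : ∫ x, θ x * (Δ (G s)) x = ∫ x, (Δ θ) x * G s x :=
    kernelCalculus_integral_mul_laplacian hθ hθc hGs
  have hcalc : ∫ x, fderiv ℝ (uncurry Φ) (s, x) (1, 0) =
      ∫ x, (fderiv ℝ (uncurry q) (s, x) (1, 0) * cutoff R x +
          fderiv ℝ (fun y => q s y * cutoff R y) x (u s x) -
          ν * (Δ (fun y => q s y * cutoff R y)) x) * G s x := by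
   calc ∫ x, fderiv ℝ (uncurry Φ) (s, x) (1, 0)
      = ∫ x, (fderiv ℝ (uncurry q) (s, x) (1, 0) * cutoff R x * G s x -
          θ x * fderiv ℝ (G s) x (u s x) - ν * (θ x * (Δ (G s)) x)) :=
        integral_congr_ae (Eventually.of_forall hpt)
    _ = (∫ x, fderiv ℝ (uncurry q) (s, x) (1, 0) * cutoff R x * G s x) -
          (∫ x, θ x * fderiv ℝ (G s) x (u s x)) - ν * ∫ x, θ x * (Δ (G s)) x := by
        have hiAB : Integrable fun x => fderiv ℝ (uncurry q) (s, x) (1, 0) * cutoff R x * G s x -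
            θ x * fderiv ℝ (G s) x (u s x) := hiA.sub hiB
        have hiνC : Integrable fun x => ν * (θ x * (Δ (G s)) x) := hiC.const_mul ν
        rw [integral_sub hiAB hiνC, integral_sub hiA hiB, integral_const_mul]
    _ = (∫ x, fderiv ℝ (uncurry q) (s, x) (1, 0) * cutoff R x * G s x) +
          (∫ x, fderiv ℝ θ x (u s x) * G s x) - ν * ∫ x, (Δ θ) x * G s x := by
        rw [hI1, hI2]; ring
    _ = ∫ x, (fderiv ℝ (uncurry q) (s, x) (1, 0) * cutoff R x * G s x +
          fderiv ℝ θ x (u s x) * G s x - ν * ((Δ θ) x * G s x)) := by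
        have hiAB : Integrable fun x => fderiv ℝ (uncurry q) (s, x) (1, 0) * cutoff R x * G s x +
            fderiv ℝ θ x (u s x) * G s x := hiA.add hiB'
        have hiνC : Integrable fun x => ν * ((Δ θ) x * G s x) := hiC'.const_mul ν
        rw [integral_sub hiAB hiνC, integral_add hiA hiB', integral_const_mul]
    _ = _ := integral_congr_ae (Eventually.of_forall fun x => by rw [hθdef]; ring)
  have hfin := hA.congr_deriv hcalc
  rw [hΦ] at hfin
  exact hfin


end General

end Summit.NavierStokesRegularity.NavierStokesRegularity.Theorems.AdaptedFrequencyConverges.TauberianOmegaLimit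

end
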